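import Summits.QuantumFields.GaugeBoot.BootstrapGramCertificates
import Summits.QuantumFields.GaugeBoot.StrongCouplingOrderSuN
import HarnessLib

/-!
# Closedness of certificate cones: `SOS(span m) + L` is closed when a faithful functional vanishes on `L`; the Wilson state is faithful at every `β` (gauge-boot, L1/L4 supplement)

HONEST FRAMING (cell `pub-gaugeboot`, page 1 of every file): the venture produces certified bounds
on lattice expectations at stated coupling, gauge group, dimension and torus size; NOT a mass gap,
NOT a continuum limit, NOT a string tension; NOT Yang–Mills-summit-bearing (barriers
`FixedCouplingUltralocality`, `PerturbativeInvisibility`). Topology/linear algebra; it certifies no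
number.

## Content (the ingredient that removes the `ε` from certificate completeness — see
`BootstrapExactCertificates.lean`)

* `isClosed_setOf_posSemidef` — the PSD real matrices form a closed set; `gramFormₗ`,
  `continuous_gramForm` — the Gram form `Q ↦ Σ Q_{ij} m_i m_j` is linear and continuous;
* ★ `isClosed_sosCone_add_of_faithful` (any configuration space `ι → G`, `G` compact): if `m` is
  a finite LINEARLY INDEPENDENT family of observables, `L` a finite-dimensional subspace and `φ` a
  linear functional vanishing on `L`, bounded by the sup norm and STRICTLY positive on the non-zero
  squares of `span m`, then `{s + ρ | s ∈ sosCone (span m), ρ ∈ L}` is closed. Mechanism: along a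
  convergent sequence `G(Q_k) + ρ_k` (`Q_k` PSD Gram matrices) the values `φ(G Q_k) = φ(x_k)` stay
  bounded, and `φ ∘ G ≥ δ ‖·‖` on the PSD cone with `δ > 0` (minimum of a continuous positive
  function on the compact PSD unit sphere — positivity because `Q = Σ BᵀB` and `φ` is faithful on
  squares, `m` independent), so `(Q_k)` is bounded; Bolzano–Weierstrass, closedness of the PSD
  cone and of the finite-dimensional `L` finish;
* ★ `isOpenPosMeasure_wilsonMeasure`, `eq_zero_of_wilson_integral_mul_self_eq_zero` — on every
  torus and at EVERY real `β` the Wilson measure charges every non-empty open set (density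
  `e^{-βS} ≥ e^{-|β| ‖S‖}` against product Haar), so a continuous observable with `∫ f² dμ_β = 0`
  vanishes; `expectationFunctional_le_norm`.

References: Rockafellar, Convex Analysis, §9 (closed sums of cones); Blekherman–Parrilo–Thomas
(2012) §3. Folklore.
-/

noncomputable section

open MeasureTheory Filter Topology NormedSpace Matrix
open scoped MatrixOrder Matrix.Norms.Elementwise
open Literature.MathematicalPhysics.QuantumFieldTheory (LatticeRep Edge GaugeConfig wilsonAction
  wilsonWeight partitionFunction wilsonMeasure isProbabilityMeasure_wilsonMeasure haarProbability)
open Literature.MathematicalPhysics.QuantumLattice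

namespace Summit.QuantumFields.GaugeBoot

open OrderUnitDuality

/-! ## The PSD cone of real matrices: closed; a Gram-positive functional dominates the norm -/

section PSD

variable {σ : Type*} [Fintype σ]

/-- The positive semidefinite real matrices form a closed set (in the entrywise topology). -/
theorem isClosed_setOf_posSemidef : IsClosed {Q : Matrix σ σ ℝ | Q.PosSemidef} := by
  have h : {Q : Matrix σ σ ℝ | Q.PosSemidef} =
      {Q : Matrix σ σ ℝ | Qᴴ = Q} ∩ ⋂ x : σ → ℝ, {Q : Matrix σ σ ℝ | 0 ≤ star x ⬝ᵥ (Q *ᵥ x)} := by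
    ext Q
    simp only [Set.mem_setOf_eq, Set.mem_inter_iff, Set.mem_iInter, posSemidef_iff_dotProduct_mulVec]
    rfl
  rw [h]
  refine IsClosed.inter (isClosed_eq (continuous_id.matrix_conjTranspose) continuous_id)
    (isClosed_iInter fun x => isClosed_le continuous_const ?_)
  exact continuous_const.dotProduct (continuous_id.matrix_mulVec continuous_const)

end PSD

/-! ## Closedness of `SOS + L` from a faithful functional -/

section Closed

variable {ι : Type*} {G : Type*} [TopologicalSpace G] [CompactSpace G] {σ : Type*} [Fintype σ]
  [DecidableEq σ]

omit [CompactSpace G] [DecidableEq σ] in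
/-- The Gram form as a linear map of the matrix. -/
theorem gramForm_eq_sum (m : σ → C(ι → G, ℝ)) (Q : Matrix σ σ ℝ) :
    gramForm m Q = ∑ i, ∑ j, Q i j • (m i * m j) := rfl

/-- **The Gram form as a linear map** `Q ↦ Σ Q_{ij} m_i m_j`. [folklore] -/
def gramFormₗ (m : σ → C(ι → G, ℝ)) : Matrix σ σ ℝ →ₗ[ℝ] C(ι → G, ℝ) where
  toFun := gramForm m
  map_add' := gramForm_add m
  map_smul' c Q := gramForm_smul m c Q

omit [CompactSpace G] [DecidableEq σ] in
/-- `gramFormₗ` is `gramForm`. -/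
@[simp] theorem gramFormₗ_apply (m : σ → C(ι → G, ℝ)) (Q : Matrix σ σ ℝ) :
    gramFormₗ m Q = gramForm m Q := rfl

omit [DecidableEq σ] in
/-- The Gram form is continuous in the matrix (a finite sum of scalar multiples). -/
theorem continuous_gramForm (m : σ → C(ι → G, ℝ)) : Continuous fun Q : Matrix σ σ ℝ => gramForm m Q := by
  simp only [gramForm_eq_sum]
  refine continuous_finsetSum _ fun i _ => continuous_finsetSum _ fun j _ => ?_
  exact (continuous_id.matrix_elem i j).smul continuous_const

/-- ★ **`SOS(span m) + L` is closed** when `m` is linearly independent, `L` is a finite-dimensional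
subspace, and some linear `φ`, bounded by the sup norm, vanishes on `L` and is strictly positive on
the non-zero squares of `span m`. [folklore] -/
theorem isClosed_sosCone_add_of_faithful (m : σ → C(ι → G, ℝ)) (hm : LinearIndependent ℝ m)
    (L : Submodule ℝ C(ι → G, ℝ)) [FiniteDimensional ℝ L] (φ : C(ι → G, ℝ) →ₗ[ℝ] ℝ)
    (hφL : ∀ x ∈ L, φ x = 0) {C : ℝ} (hC : 0 ≤ C) (hφC : ∀ f, φ f ≤ C * ‖f‖)
    (hφpos : ∀ v ∈ Submodule.span ℝ (Set.range m), v ≠ 0 → 0 < φ (v * v)) :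
    IsClosed {x : C(ι → G, ℝ) | ∃ s ∈ sosCone (Submodule.span ℝ (Set.range m) : Set C(ι → G, ℝ)),
      ∃ ρ ∈ L, s + ρ = x} := by
  -- (1) `φ ∘ gramForm` is positive on non-zero PSD matrices
  have hpos : ∀ Q : Matrix σ σ ℝ, Q.PosSemidef → Q ≠ 0 → 0 < φ (gramForm m Q) := by
    intro Q hQ hQ0
    have hQ' : (0 : Matrix σ σ ℝ) ≤ Q := Matrix.nonneg_iff_posSemidef.2 hQ
    rw [StarOrderedRing.nonneg_iff] at hQ'
    -- along the additive closure: `φ (gramForm Q) ≥ 0`, and `= 0` forces `Q = 0`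
    have key : ∀ Q ∈ AddSubmonoid.closure (Set.range fun s : Matrix σ σ ℝ => star s * s),
        0 ≤ φ (gramForm m Q) ∧ (φ (gramForm m Q) = 0 → Q = 0) := by
      intro Q hQ
      induction hQ using AddSubmonoid.closure_induction with
      | mem Q₁ hQ₁ =>
        obtain ⟨B, rfl⟩ := Set.mem_range.1 hQ₁
        have hB : star B * B = Bᵀ * B := by rw [Matrix.star_eq_conjTranspose]; rfl
        rw [hB, gramForm_transpose_mul_self, map_sum]
        have hnn : ∀ k, 0 ≤ φ ((∑ i, B k i • m i) * (∑ i, B k i • m i)) := fun k => by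
          by_cases h0 : ∑ i, B k i • m i = 0
          · rw [h0, mul_zero, map_zero]
          · exact (hφpos _ (Submodule.sum_mem _ fun i _ =>
              Submodule.smul_mem _ _ (Submodule.subset_span (Set.mem_range_self i))) h0).le
        refine ⟨Finset.sum_nonneg fun k _ => hnn k, fun hsum => ?_⟩
        have hrow : ∀ k, ∑ i, B k i • m i = 0 := fun k => by
          by_contra h0
          have hk := hφpos _ (Submodule.sum_mem _ fun i _ =>
            Submodule.smul_mem _ _ (Submodule.subset_span (Set.mem_range_self i))) h0
          have := (Finset.sum_eq_zero_iff_of_nonneg fun k _ => hnn k).1 hsum k (Finset.mem_univ k)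
          linarith
        have hB0 : B = 0 := by
          ext k i
          rw [Matrix.zero_apply]
          exact linearIndependent_iff'.1 hm Finset.univ (fun i => B k i) (hrow k) i (Finset.mem_univ i)
        rw [hB0, Matrix.mul_zero]
      | zero => exact ⟨by rw [gramForm_zero, map_zero], fun _ => rfl⟩
      | add Q₁ Q₂ hQ₁m hQ₂m h₁ h₂ =>
        rw [gramForm_add, map_add]
        refine ⟨add_nonneg h₁.1 h₂.1, fun h => ?_⟩
        have e1 : φ (gramForm m Q₁) = 0 := by linarith [h₁.1, h₂.1]
        have e2 : φ (gramForm m Q₂) = 0 := by linarith [h₁.1, h₂.1]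
        rw [h₁.2 e1, h₂.2 e2, add_zero]
    obtain ⟨hnn, hzero⟩ := key Q hQ'
    exact lt_of_le_of_ne hnn fun h => hQ0 (hzero h.symm)
  -- (2) a uniform constant: `δ ‖Q‖ ≤ φ (gramForm Q)` on the PSD cone
  obtain ⟨δ, hδ, hdom⟩ : ∃ δ : ℝ, 0 < δ ∧ ∀ Q : Matrix σ σ ℝ, Q.PosSemidef → δ * ‖Q‖ ≤ φ (gramForm m Q) := by
    set B := {Q : Matrix σ σ ℝ | Q.PosSemidef} ∩ Metric.sphere (0 : Matrix σ σ ℝ) 1 with hB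
    have hBc : IsCompact B := Metric.isCompact_of_isClosed_isBounded
      (isClosed_setOf_posSemidef.inter Metric.isClosed_sphere)
      (Metric.isBounded_sphere.subset Set.inter_subset_right)
    have hcont : Continuous fun Q : Matrix σ σ ℝ => φ (gramForm m Q) :=
      (φ ∘ₗ gramFormₗ m).continuous_of_finiteDimensional
    by_cases hne : B.Nonempty
    · obtain ⟨Q₀, hQ₀B, hmin⟩ := hBc.exists_isMinOn hne hcont.continuousOn
      have hQ₀ne : Q₀ ≠ 0 := by
        intro h; have := hQ₀B.2; rw [h, Metric.mem_sphere, dist_self] at this; exact zero_ne_one this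
      refine ⟨φ (gramForm m Q₀), hpos Q₀ hQ₀B.1 hQ₀ne, fun Q hQ => ?_⟩
      by_cases hQ0 : Q = 0
      · rw [hQ0, norm_zero, mul_zero, gramForm_zero, map_zero]
      · have hnorm : 0 < ‖Q‖ := norm_pos_iff.2 hQ0
        have hmem : ‖Q‖⁻¹ • Q ∈ B := by
          refine ⟨hQ.smul (inv_nonneg.2 hnorm.le), ?_⟩
          rw [Metric.mem_sphere, dist_zero_right, norm_smul, norm_inv, norm_norm,
            inv_mul_cancel₀ hnorm.ne']
        have h := (isMinOn_iff.1 hmin) _ hmem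
        rw [gramForm_smul, map_smul, smul_eq_mul, le_inv_mul_iff₀ hnorm] at h
        rw [mul_comm]
        exact h
    · refine ⟨1, one_pos, fun Q hQ => ?_⟩
      by_cases hQ0 : Q = 0
      · rw [hQ0, norm_zero, mul_zero, gramForm_zero, map_zero]
      · exfalso
        have hnorm : 0 < ‖Q‖ := norm_pos_iff.2 hQ0
        refine hne ⟨‖Q‖⁻¹ • Q, hQ.smul (inv_nonneg.2 hnorm.le), ?_⟩
        rw [Metric.mem_sphere, dist_zero_right, norm_smul, norm_inv, norm_norm,
          inv_mul_cancel₀ hnorm.ne']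
  -- (3) sequential closedness
  refine IsSeqClosed.isClosed fun x y hx hxy => ?_
  choose s hs ρ hρ hsum using hx
  choose Q hQ hGQ using fun k => exists_posSemidef_of_mem_sosCone m (hs k)
  -- the matrices are bounded
  obtain ⟨R, hR⟩ : ∃ R, ∀ k, ‖x k‖ ≤ R := by
    obtain ⟨R, hR⟩ := (Metric.isBounded_range_of_tendsto x hxy).exists_norm_le
    exact ⟨R, fun k => hR _ (Set.mem_range_self k)⟩
  have hQbd : ∀ k, ‖Q k‖ ≤ C * R / δ := by
    intro k
    have h1 := hdom (Q k) (hQ k)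
    have h2 : φ (gramForm m (Q k)) = φ (x k) := by
      rw [← hsum k, map_add, hφL _ (hρ k), add_zero, hGQ k]
    have h3 : φ (x k) ≤ C * R := (hφC (x k)).trans (mul_le_mul_of_nonneg_left (hR k) hC)
    rw [le_div_iff₀ hδ, mul_comm]
    linarith
  obtain ⟨Qlim, -, ψ, hψ, hlim⟩ := (isCompact_closedBall (0 : Matrix σ σ ℝ) (C * R / δ)).tendsto_subseq
    (x := Q) fun k => by
      rw [Metric.mem_closedBall, dist_zero_right]; exact hQbd k
  have hQlim : Qlim.PosSemidef := isClosed_setOf_posSemidef.mem_of_tendsto hlim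
    (Eventually.of_forall fun k => hQ (ψ k))
  -- the row parts converge too, to an element of the closed subspace `L`
  have hρlim : Tendsto (fun k => ρ (ψ k)) atTop (𝓝 (y - gramForm m Qlim)) := by
    have h1 : Tendsto (fun k => x (ψ k)) atTop (𝓝 y) := hxy.comp hψ.tendsto_atTop
    have h2 : Tendsto (fun k => gramForm m (Q (ψ k))) atTop (𝓝 (gramForm m Qlim)) :=
      (continuous_gramForm m).continuousAt.tendsto.comp hlim
    have h3 : (fun k => ρ (ψ k)) = fun k => x (ψ k) - gramForm m (Q (ψ k)) := by
      funext k; rw [← hsum (ψ k), hGQ]; abel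
    rw [h3]
    exact h1.sub h2
  have hρlim_mem : y - gramForm m Qlim ∈ L :=
    (L.closed_of_finiteDimensional).mem_of_tendsto hρlim (Eventually.of_forall fun k => hρ (ψ k))
  refine ⟨gramForm m Qlim, (mem_sosCone_span_iff_exists_posSemidef m).2 ⟨Qlim, hQlim, rfl⟩,
    y - gramForm m Qlim, hρlim_mem, by abel⟩

end Closed

/-! ## The Wilson measure is faithful at every coupling -/

section Torus

variable {d L : ℕ} [NeZero L] {G : Type*} [Group G] [TopologicalSpace G] [IsTopologicalGroup G]
  [CompactSpace G] [MeasurableSpace G] [BorelSpace G] [SecondCountableTopology G] (r : LatticeRep G)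

/-- **The Wilson measure charges every non-empty open set**, at every real `β` (positive density
w.r.t. the product Haar measure). [folklore] -/
theorem isOpenPosMeasure_wilsonMeasure (β : ℝ)
    [IsProbabilityMeasure (wilsonMeasure (d := d) (L := L) r.ρ β)] :
    (wilsonMeasure (d := d) (L := L) r.ρ β).IsOpenPosMeasure := by
  haveI : (haarProbability G).IsOpenPosMeasure := by unfold haarProbability; infer_instance
  -- a positive lower bound on the density
  set c : ENNReal := ENNReal.ofReal (Real.exp (-(|β| * ‖wilsonActionCM (d := d) (L := L) r‖))) with hc
  have hc0 : c ≠ 0 := (ENNReal.ofReal_pos.2 (Real.exp_pos _)).ne'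
  have hcle : ∀ U : GaugeConfig d L G, c ≤ ENNReal.ofReal (Real.exp (-β * wilsonAction r.ρ U)) := by
    intro U
    refine ENNReal.ofReal_le_ofReal (Real.exp_le_exp.2 ?_)
    have h1 : |β * wilsonAction r.ρ U| ≤ |β| * ‖wilsonActionCM (d := d) (L := L) r‖ := by
      rw [abs_mul]
      refine mul_le_mul_of_nonneg_left ?_ (abs_nonneg β)
      have h := (wilsonActionCM (d := d) (L := L) r).norm_coe_le_norm U
      rwa [coe_wilsonActionCM, Real.norm_eq_abs] at h
    have h2 := le_abs_self (β * wilsonAction r.ρ U)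
    rw [neg_mul]
    linarith
  refine ⟨fun U hU hne => ?_⟩
  have hZ : (partitionFunction (d := d) (L := L) r.ρ β)⁻¹ ≠ 0 := by
    intro h0
    have h1 := measure_univ (μ := wilsonMeasure (d := d) (L := L) r.ρ β)
    unfold wilsonMeasure at h1
    rw [Measure.smul_apply, smul_eq_mul, h0, zero_mul] at h1
    exact zero_ne_one h1
  unfold wilsonMeasure
  rw [Measure.smul_apply, smul_eq_mul]
  refine mul_ne_zero hZ (ne_of_gt ?_)
  unfold wilsonWeight
  rw [withDensity_apply _ hU.measurableSet]
  have hpos : 0 < c * (Measure.pi fun _ : Edge d L => haarProbability G) U :=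
    ENNReal.mul_pos hc0 (hU.measure_ne_zero _ hne)
  refine lt_of_lt_of_le hpos ?_
  rw [← setLIntegral_const]
  exact setLIntegral_mono' hU.measurableSet fun U _ => hcle U

/-- ★ **Faithfulness of the Wilson state at every `β`**: a continuous observable with
`∫ f² dμ_β = 0` vanishes. [folklore] -/
theorem eq_zero_of_wilson_integral_mul_self_eq_zero (β : ℝ)
    [IsProbabilityMeasure (wilsonMeasure (d := d) (L := L) r.ρ β)]
    (f : C(GaugeConfig d L G, ℝ)) (h : ∫ U, (f * f) U ∂(wilsonMeasure (d := d) (L := L) r.ρ β) = 0) :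
    f = 0 := by
  haveI := isOpenPosMeasure_wilsonMeasure (d := d) (L := L) r β
  have hc : Continuous fun U : GaugeConfig d L G => f U * f U := f.continuous.mul f.continuous
  have hae := (integral_eq_zero_iff_of_nonneg (fun U => mul_self_nonneg (f U))
    (integrable_of_continuous_compact hc _)).1 (by simpa only [ContinuousMap.mul_apply] using h)
  have hz : (fun U : GaugeConfig d L G => f U * f U) = fun _ => 0 :=
    (Continuous.ae_eq_iff_eq (wilsonMeasure (d := d) (L := L) r.ρ β) hc continuous_const).1 hae
  ext U
  simpa using congrFun hz U

omit [Group G] [IsTopologicalGroup G] in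
/-- The expectation functional of a probability measure is bounded by the sup norm. -/
theorem expectationFunctional_le_norm (μ : Measure (GaugeConfig d L G)) [IsProbabilityMeasure μ]
    (f : C(GaugeConfig d L G, ℝ)) : expectationFunctional μ f ≤ 1 * ‖f‖ := by
  rw [expectationFunctional_apply, one_mul]
  calc ∫ U, f U ∂μ ≤ ∫ _, ‖f‖ ∂μ :=
        integral_mono (integrable_of_continuous_compact f.continuous μ) (integrable_const _)
          fun U => (Real.le_norm_self _).trans (f.norm_coe_le_norm U)
    _ = ‖f‖ := by simp

end Torus

end Summit.QuantumFields.GaugeBoot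

end
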